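import Summits.Ventures.PercRepro.RankLevelSetLevelSixHeavyCellSq27DI
import Summits.Ventures.PercRepro.RankLevelSetLevelSixCapGlue25
import Summits.Ventures.PercRepro.TriangleCapEightI
import Summits.Ventures.PercRepro.S1TrianglePlusSharp
import Summits.Ventures.PercRepro.S1SeriesLever14
import Summits.Ventures.PercRepro.RankLevelSetLevelSixArithHeavySq25DIA
import Summits.Ventures.PercRepro.RankLevelSetLevelSixArithHeavySq25DIB
import Summits.Ventures.PercRepro.RankLevelSetLevelSixArithHeavySq25DIC
import Summits.Ventures.PercRepro.RankLevelSetLevelSixArithHeavySq25DID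
import Summits.Ventures.PercRepro.RankLevelSetLevelSixArithHeavySq25DIE

/-!
# PercRepro — THE 25 ROW, THE COLOOP-FREE CELLS `(p ≥ 25, 7 ≤ d ≤ 14)` (p8 g9, S3)

`proofs/SUBCLAIM-S3-p8.md` §3w (THE 25 ROW). Axioms: standard.
-/

open scoped Matroid

namespace PercRepro

namespace ThmN

open Set

variable {α : Type}

/-- **The COLOOP-FREE `e`-free core at level `6`, corank `7 ≤ d ≤ 14`, rank `p ≥ 25`** (the corrected cell `c025_core_six_heavy_cell_sq27di` (d3391) with the per-corank parameters of ArithHeavySq25DIA … E and the coloop-free caps: the triangle step `s3_cf_of`, the step on `avgChain14 (d − 1)` with `m = 25 + d` (`s4_cf_of`; at `d = 8` p2's series lever `gb14 8 33 = 62`, S1SeriesLever14), the step on `avgChain5c (d − 1)` (`s5_cf_of`)). -/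
theorem c025_core_six_bounded_corank_heavy_sq25_free (M : Matroid α) [M.Finite] (p d : ℕ) (hp : 25 ≤ p) (hd7 : 7 ≤ d) (hd14 : d ≤ 14) (hcf : ∀ e ∈ M.E, ¬ M.IsColoop e)
    (hR : M.eRank = (p : ℕ∞)) (hn : M.E.ncard = p + d)
    (hfree : ∀ e ∈ M.E, ∃ A ⊆ M.E \ {e}, e ∉ M.closure A ∧ e ∉ M.closure ((M.E \ {e}) \ A)) :
    RLS M p 6 := by
  have hd : M.E.encard = M.eRank + d := by
    rw [hR, ← M.ground_finite.cast_ncard_eq, hn]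
    push_cast
    ring
  have hL : ∀ e ∈ M.E, ¬ M.IsLoop e := not_isLoop_of_free M hfree
  have hs : ∀ e ∈ M.E, ∀ f ∈ M.E, e ≠ f → M.eRk {e, f} = 2 := by
    intro e he f hf hef
    have h2 : (2 : ℕ∞) ≤ M.eRk {e, f} :=
      two_le_eRk_of_two_le_ncard_of_free M hfree (pair_subset he hf) (by rw [ncard_pair hef])
    have h3 : M.eRk {e, f} ≤ 2 := by
      have := M.eRk_le_encard {e, f}
      rwa [encard_pair hef] at this
    exact le_antisymm h3 h2
  have hC1 : ∀ L ⊆ M.E, M.eRk L = 2 → L.ncard ≤ 3 :=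
    fun L hL hr => ncard_le_three_of_eRk_two M hs hfree hL hr
  have hC2 : ∀ P ⊆ M.E, M.eRk P ≤ 3 → P.ncard ≤ 6 :=
    fun P hP hr => ncard_le_six_of_eRk_le_three_of_free M hfree hP hr
  have hΦ : phiK p 6 ≤ (2 : ℚ) ^ (p + 6) / (((p + 6).choose 6 : ℕ) : ℚ) := phiK_le_two_pow_div_six p
  rw [RLS_iff]
  interval_cases d
  · exact c025_core_six_heavy_cell_sq27di M p 7 7 1 1 13 12 0 303023 1000 13 248 46 11
      ((p + 6).choose 6) (Nat.choose_pos (by omega)) (phiK p 6) hΦ (by norm_num) (by omega)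
      (by norm_num) (by norm_num) (by norm_num) (by norm_num) (by norm_num)
      (by norm_num [cnull]) (by norm_num [cnull]) (Or.inl (by norm_num)) (Or.inl (by norm_num)) (Or.inl (by norm_num)) (by norm_num) (by norm_num) (by norm_num)
      (s3_cf_of M hfree hcf (d := 6) (by simpa using hd) 32 11 (by norm_num) (by omega) (by norm_num [TriangleCap.cq3]) (by norm_num [TriangleCap.cq3]) (by norm_num [TriangleCap.cq3]))
      (s4_cf_of M hfree hcf (d := 6) (by rw [hd]; norm_num) 32 41 46 (by norm_num) (by omega) (by decide) (by omega))
      (s5_cf_of M hfree hcf (d := 6) (by rw [hd]; norm_num) 32 210 248 (by norm_num) (by omega) (by decide) (by omega))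
      (Or.inl (tail_six_heavy_sq25DI_7 p hp)) hR hn hfree (level_six_poly_heavy_sq25DI_7 p hp)
  · exact c025_core_six_heavy_cell_sq27di M p 8 7 2 1 16 14 0 245299 1000 14 424 62 12
      ((p + 6).choose 6) (Nat.choose_pos (by omega)) (phiK p 6) hΦ (by norm_num) (by omega)
      (by norm_num) (by norm_num) (by norm_num) (by norm_num) (by norm_num)
      (by norm_num [cnull]) (by norm_num [cnull]) (Or.inl (by norm_num)) (Or.inl (by norm_num)) (Or.inl (by norm_num)) (by norm_num) (by norm_num) (by norm_num)
      (s3_cf_of M hfree hcf (d := 7) (by simpa using hd) 33 12 (by norm_num) (by omega) (by norm_num [TriangleCap.cq3]) (by norm_num [TriangleCap.cq3]) (by norm_num [TriangleCap.cq3]))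
      ((S1.ncard_fourCircuits_le_gb14 8 M hfree hd 33 (by rw [coloops_eq_empty_of_forall M hcf, Set.sdiff_empty, hn]; omega)).trans (by decide))
      (s5_cf_of M hfree hcf (d := 7) (by rw [hd]; norm_num) 33 360 424 (by norm_num) (by omega) (by decide) (by omega))
      (Or.inl (tail_six_heavy_sq25DI_8 p hp)) hR hn hfree (level_six_poly_heavy_sq25DI_8 p hp)
  · exact c025_core_six_heavy_cell_sq27di M p 9 8 1 1 16 14 0 166481 1000 15 685 99 14
      ((p + 6).choose 6) (Nat.choose_pos (by omega)) (phiK p 6) hΦ (by norm_num) (by omega)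
      (by norm_num) (by norm_num) (by norm_num) (by norm_num) (by norm_num)
      (by norm_num [cnull]) (by norm_num [cnull]) (Or.inl (by norm_num)) (Or.inr (Or.inl ⟨by norm_num, by norm_num⟩)) (Or.inl (by norm_num)) (by norm_num) (by norm_num) (by norm_num)
      (s3_cf_of M hfree hcf (d := 8) (by simpa using hd) 34 14 (by norm_num) (by omega) (by norm_num [TriangleCap.cq3]) (by norm_num [TriangleCap.cq3]) (by norm_num [TriangleCap.cq3]))
      (s4_cf_of M hfree hcf (d := 8) (by rw [hd]; norm_num) 34 88 99 (by norm_num) (by omega) (by decide) (by omega))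
      (s5_cf_of M hfree hcf (d := 8) (by rw [hd]; norm_num) 34 585 685 (by norm_num) (by omega) (by decide) (by omega))
      (Or.inl (tail_six_heavy_sq25DI_9 p hp)) hR hn hfree (level_six_poly_heavy_sq25DI_9 p hp)
  · exact c025_core_six_heavy_cell_sq27di M p 10 9 1 1 17 15 0 104800 1000 16 1061 138 17
      ((p + 6).choose 6) (Nat.choose_pos (by omega)) (phiK p 6) hΦ (by norm_num) (by omega)
      (by norm_num) (by norm_num) (by norm_num) (by norm_num) (by norm_num)
      (by norm_num [cnull]) (by norm_num [cnull]) (Or.inl (by norm_num)) (Or.inr (Or.inl ⟨by norm_num, by norm_num⟩)) (Or.inl (by norm_num)) (by norm_num) (by norm_num) (by norm_num)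
      (s3_cf_of M hfree hcf (d := 9) (by simpa using hd) 35 17 (by norm_num) (by omega) (by norm_num [TriangleCap.cq3]) (by norm_num [TriangleCap.cq3]) (by norm_num [TriangleCap.cq3]))
      (s4_cf_of M hfree hcf (d := 9) (by rw [hd]; norm_num) 35 123 138 (by norm_num) (by omega) (by decide) (by omega))
      (s5_cf_of M hfree hcf (d := 9) (by rw [hd]; norm_num) 35 910 1061 (by norm_num) (by omega) (by decide) (by omega))
      (Or.inl (tail_six_heavy_sq25DI_10 p hp)) hR hn hfree (level_six_poly_heavy_sq25DI_10 p hp)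
  · exact c025_core_six_heavy_cell_sq27di M p 11 9 1 1 19 16 0 65347 1000 17 1585 187 21
      ((p + 6).choose 6) (Nat.choose_pos (by omega)) (phiK p 6) hΦ (by norm_num) (by omega)
      (by norm_num) (by norm_num) (by norm_num) (by norm_num) (by norm_num)
      (by norm_num [cnull]) (by norm_num [cnull]) (Or.inl (by norm_num)) (Or.inr (Or.inl ⟨by norm_num, by norm_num⟩)) (Or.inl (by norm_num)) (by norm_num) (by norm_num) (by norm_num)
      (s3_cf_of M hfree hcf (d := 10) (by simpa using hd) 36 21 (by norm_num) (by omega) (by norm_num [TriangleCap.cq3]) (by norm_num [TriangleCap.cq3]) (by norm_num [TriangleCap.cq3]))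
      (s4_cf_of M hfree hcf (d := 10) (by rw [hd]; norm_num) 36 167 187 (by norm_num) (by omega) (by decide) (by omega))
      (s5_cf_of M hfree hcf (d := 10) (by rw [hd]; norm_num) 36 1365 1585 (by norm_num) (by omega) (by decide) (by omega))
      (Or.inl (tail_six_heavy_sq25DI_11 p hp)) hR hn hfree (level_six_poly_heavy_sq25DI_11 p hp)
  · exact c025_core_six_heavy_cell_sq27di M p 12 10 1 1 20 17 0 41259 1000 18 2295 248 26
      ((p + 6).choose 6) (Nat.choose_pos (by omega)) (phiK p 6) hΦ (by norm_num) (by omega)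
      (by norm_num) (by norm_num) (by norm_num) (by norm_num) (by norm_num)
      (by norm_num [cnull]) (by norm_num [cnull]) (Or.inl (by norm_num)) (Or.inr (Or.inl ⟨by norm_num, by norm_num⟩)) (Or.inl (by norm_num)) (by norm_num) (by norm_num) (by norm_num)
      (s3_cf_of M hfree hcf (d := 11) (by simpa using hd) 37 26 (by norm_num) (by omega) (by norm_num [TriangleCap.cq3]) (by norm_num [TriangleCap.cq3]) (by norm_num [TriangleCap.cq3]))
      (s4_cf_of M hfree hcf (d := 11) (by rw [hd]; norm_num) 37 222 248 (by norm_num) (by omega) (by decide) (by omega))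
      (s5_cf_of M hfree hcf (d := 11) (by rw [hd]; norm_num) 37 1985 2295 (by norm_num) (by omega) (by decide) (by omega))
      (Or.inl (tail_six_heavy_sq25DI_12 p hp)) hR hn hfree (level_six_poly_heavy_sq25DI_12 p hp)
  · exact c025_core_six_heavy_cell_sq27di M p 13 10 1 1 22 18 0 27025 1000 19 3238 324 31
      ((p + 6).choose 6) (Nat.choose_pos (by omega)) (phiK p 6) hΦ (by norm_num) (by omega)
      (by norm_num) (by norm_num) (by norm_num) (by norm_num) (by norm_num)
      (by norm_num [cnull]) (by norm_num [cnull]) (Or.inl (by norm_num)) (Or.inr (Or.inl ⟨by norm_num, by norm_num⟩)) (Or.inl (by norm_num)) (by norm_num) (by norm_num) (by norm_num)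
      (s3_cf_of M hfree hcf (d := 12) (by simpa using hd) 38 31 (by norm_num) (by omega) (by norm_num [TriangleCap.cq3]) (by norm_num [TriangleCap.cq3]) (by norm_num [TriangleCap.cq3]))
      (s4_cf_of M hfree hcf (d := 12) (by rw [hd]; norm_num) 38 290 324 (by norm_num) (by omega) (by decide) (by omega))
      (s5_cf_of M hfree hcf (d := 12) (by rw [hd]; norm_num) 38 2812 3238 (by norm_num) (by omega) (by decide) (by omega))
      (Or.inl (tail_six_heavy_sq25DI_13 p hp)) hR hn hfree (level_six_poly_heavy_sq25DI_13 p hp)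
  · exact c025_core_six_heavy_cell_sq27di M p 14 11 1 1 23 19 0 18350 1000 20 4465 414 36
      ((p + 6).choose 6) (Nat.choose_pos (by omega)) (phiK p 6) hΦ (by norm_num) (by omega)
      (by norm_num) (by norm_num) (by norm_num) (by norm_num) (by norm_num)
      (by norm_num [cnull]) (by norm_num [cnull]) (Or.inl (by norm_num)) (Or.inr (Or.inl ⟨by norm_num, by norm_num⟩)) (Or.inl (by norm_num)) (by norm_num) (by norm_num) (by norm_num)
      (s3_cf_of M hfree hcf (d := 13) (by simpa using hd) 39 36 (by norm_num) (by omega) (by norm_num [TriangleCap.cq3]) (by norm_num [TriangleCap.cq3]) (by norm_num [TriangleCap.cq3]))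
      (s4_cf_of M hfree hcf (d := 13) (by rw [hd]; norm_num) 39 372 414 (by norm_num) (by omega) (by decide) (by omega))
      (s5_cf_of M hfree hcf (d := 13) (by rw [hd]; norm_num) 39 3893 4465 (by norm_num) (by omega) (by decide) (by omega))
      (Or.inl (tail_six_heavy_sq25DI_14 p hp)) hR hn hfree (level_six_poly_heavy_sq25DI_14 p hp)
end ThmN

end PercRepro
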